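import Summits.Ventures.PercRepro.S1SpreadCapsEight
import Summits.Ventures.PercRepro.S1CoreStar

/-!
# PercRepro — SERIES CLASSES IN THE SPREAD CHAIN, PART A: THE LEMMAS (p1, gen 35)

`proofs/P1-S2-CORANK6.md` §4q. The averaging recursion of the spread `s₄` chain deletes a point `x` of small degree and bounds the
four-circuits of `M ＼ {x}` by the NO-point-count cap at the lower nullity, because `M ＼ {x}` may have coloops (the series partners of
`x`). Here the coloops of `M ＼ {x}` are analysed: every circuit through `x` contains them (`mem_of_isColoop_delete_of_isCircuit`), the
relation is symmetric (`isColoop_delete_symm`), so a point with `≥ 4` series partners lies on no four-circuit and one with `2` or `3`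
on at most one (`ncard_fourCircuitsThrough_eq_zero_of_four_le_coloops_delete`, `ncard_fourCircuitsThrough_le_one_of_two_le_coloops_delete`);
deleting ALL the coloops of a matroid keeps its nullity and its circuits and leaves a coloop-free matroid
(`nullity_delete_coloops`, `fourCircuits_delete_coloops_eq`, `not_isColoop_delete_coloops`). Also: an e-free core has no circuit of
size `≤ 2` (`three_le_ncard_of_isCircuit_of_hfree`), a spread core of nullity `d ≥ 4` has at least `d + 6` points
(`nullity_add_six_le_ncard_of_spread`: a basis plus four points is a nullity-`4` set, hence has `≥ 10` points), and the no-point-count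
spread cap `s₄ ≤ capSum qSpreadSeven j` holds at EVERY nullity `j` (`ncard_fourCircuits_le_capSum_qSpreadSeven`: the spread bridge at
`j ≤ 7`, the star bound `perPointBound` beyond). Part B (`S1SpreadSeriesChain`) assembles the series-aware chain. Axioms: standard.
-/

open scoped Matroid

namespace PercRepro

namespace S1

open Set

open FourCap

variable {α : Type}

/-- **An e-free core has no circuit of size `≤ 2`** (no loops, every pair independent). -/
theorem three_le_ncard_of_isCircuit_of_hfree (M : Matroid α) [M.Finite]
    (hfree : ∀ e ∈ M.E, ∃ A ⊆ M.E \ {e}, e ∉ M.closure A ∧ e ∉ M.closure ((M.E \ {e}) \ A))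
    {C : Set α} (hC : M.IsCircuit C) : 3 ≤ C.ncard := by
  have hCf : C.Finite := M.ground_finite.subset hC.subset_ground
  have hne := hC.nonempty
  have hpos : 0 < C.ncard := (ncard_pos hCf).2 hne
  by_contra hlt
  push Not at hlt
  have h := hC.eRk_add_one_eq
  rw [← hCf.cast_ncard_eq] at h
  rcases Nat.lt_or_ge C.ncard 2 with h1 | h2
  · -- a loop
    have h1' : C.ncard = 1 := by omega
    obtain ⟨a, rfl⟩ := ncard_eq_one.1 h1'
    have ha : a ∈ M.E := hC.subset_ground (mem_singleton a)
    have hr : M.eRk {a} = 0 := by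
      rw [h1'] at h
      have h' : M.eRk {a} + ((1 : ℕ) : ℕ∞) = 0 + ((1 : ℕ) : ℕ∞) := by rw [zero_add]; exact h
      exact WithTop.add_right_cancel (WithTop.coe_ne_top) h'
    have hsub : ({a} : Set α) ⊆ M.loops := (Matroid.eRk_eq_zero_iff (M := M) (X := {a}) (by simpa)).1 hr
    exact ThmN.not_isLoop_of_free M hfree a ha (Matroid.isLoop_iff.2 (singleton_subset_iff.1 hsub))
  · -- a parallel pair
    have h2' : C.ncard = 2 := by omega
    obtain ⟨a, b, hab, rfl⟩ := ncard_eq_two.1 h2'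
    have ha : a ∈ M.E := hC.subset_ground (by simp)
    have hb : b ∈ M.E := hC.subset_ground (by simp)
    have hr := eRk_pair_eq_two M hfree ha hb hab
    rw [h2', hr] at h
    norm_num at h

/-- **A spread core of nullity `d ≥ 4` has at least `d + 6` points**: a basis plus four further points is a set of nullity exactly `4`,
hence has `≥ 10` points, so the rank is `≥ 6`. -/
theorem nullity_add_six_le_ncard_of_spread (M : Matroid α) [M.Finite]
    (hns : ¬ ∃ W ⊆ M.E, W.ncard ≤ 9 ∧ W.encard = M.eRk W + 4) {d : ℕ} (hd : M.E.encard = M.eRank + d) (h4 : 4 ≤ d) :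
    d + 6 ≤ M.E.ncard := by
  obtain ⟨B, hB⟩ := M.exists_isBase
  have hBE : B ⊆ M.E := hB.subset_ground
  have hBenc : B.encard = M.eRank := hB.encard_eq_eRank
  have hdiff : (M.E \ B).encard = d := by
    have h := Set.encard_sdiff_add_encard_of_subset hBE
    rw [hBenc, hd] at h
    have hr : M.eRank ≠ ⊤ := PercRepro.Matroid.eRank_ne_top_of_finite M
    exact WithTop.add_right_cancel hr (h.trans (add_comm _ _))
  obtain ⟨F, hFsub, hFenc⟩ := Set.exists_subset_encard_eq (s := M.E \ B) (k := (4 : ℕ∞)) (by rw [hdiff]; exact_mod_cast h4)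
  have hFE : F ⊆ M.E := hFsub.trans sdiff_subset
  have hW : B ∪ F ⊆ M.E := union_subset hBE hFE
  have hsp : M.Spanning (B ∪ F) := hB.spanning_of_superset subset_union_left hW
  have hdisj : Disjoint B F := disjoint_sdiff_right.mono_right hFsub
  have hWenc : (B ∪ F).encard = M.eRk (B ∪ F) + 4 := by
    rw [Set.encard_union_eq hdisj, hBenc, hFenc, hsp.eRk_eq]
  have hWf : (B ∪ F).Finite := M.ground_finite.subset hW
  have h10 : 10 ≤ (B ∪ F).ncard := by
    by_contra hlt
    push Not at hlt
    exact hns ⟨B ∪ F, hW, by omega, hWenc⟩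
  -- the rank is at least `6`
  obtain ⟨r, hr⟩ := ENat.ne_top_iff_exists.1 (PercRepro.Matroid.eRank_ne_top_of_finite M)
  have hBn : B.ncard = r := by
    have := hBenc
    rw [← (M.ground_finite.subset hBE).cast_ncard_eq, ← hr] at this
    exact_mod_cast this
  have hFn : F.ncard = 4 := by
    have := hFenc
    rw [← (M.ground_finite.subset hFE).cast_ncard_eq] at this
    exact_mod_cast this
  have hWn : (B ∪ F).ncard = r + 4 := by
    rw [Set.ncard_union_eq hdisj (M.ground_finite.subset hBE) (M.ground_finite.subset hFE), hBn, hFn]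
  have hEn : M.E.ncard = r + d := by
    have := hd
    rw [← M.ground_finite.cast_ncard_eq, ← hr] at this
    exact_mod_cast this
  omega

/-- **Every circuit through `x` contains every coloop of `M ＼ {x}`** (in a coloop-free matroid): `y ∈ cl(E ∖ y)` but
`y ∉ cl(E ∖ {x, y})`, so by exchange `x ∉ cl(E ∖ {x, y})`, while a circuit `C ∋ x` avoiding `y` puts `x ∈ cl(C ∖ x) ⊆ cl(E ∖ {x, y})`. -/
theorem mem_of_isColoop_delete_of_isCircuit (M : Matroid α) (hK : ∀ e, ¬ M.IsColoop e) {x y : α}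
    (hy : (M ＼ {x}).IsColoop y) {C : Set α} (hC : M.IsCircuit C) (hxC : x ∈ C) : y ∈ C := by
  rw [Matroid.delete_isColoop_iff] at hy
  obtain ⟨hycl, hyE, hyx⟩ := hy
  have hyx' : y ≠ x := fun h => hyx (mem_singleton_iff.2 h)
  have hxE : x ∈ M.E := hC.subset_ground hxC
  by_contra hyC
  -- `y ∈ cl(E ∖ y)` since `y` is not a coloop of `M`
  have hy1 : y ∈ M.closure (M.E \ {y}) := by
    by_contra h
    exact hK y ((Matroid.isColoop_iff_notMem_closure_compl hyE).2 h)
  have hX : M.E \ {y} = insert x ((M.E \ {x}) \ {y}) := by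
    ext z
    simp only [mem_sdiff, mem_singleton_iff, mem_insert_iff]
    constructor
    · rintro ⟨hz, hzy⟩
      by_cases hzx : z = x
      · exact Or.inl hzx
      · exact Or.inr ⟨⟨hz, hzx⟩, hzy⟩
    · rintro (rfl | ⟨⟨hz, _⟩, hzy⟩)
      · exact ⟨hxE, hyx'.symm⟩
      · exact ⟨hz, hzy⟩
  rw [hX] at hy1
  have hex := Matroid.closure_exchange (M := M) (e := y) (f := x) (X := (M.E \ {x}) \ {y}) ⟨hy1, hycl⟩
  have hxcl : x ∉ M.closure ((M.E \ {x}) \ {y}) := hex.2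
  apply hxcl
  have hsub : C \ {x} ⊆ (M.E \ {x}) \ {y} := by
    intro z hz
    exact ⟨⟨hC.subset_ground hz.1, hz.2⟩, fun h => hyC (by rw [mem_singleton_iff.1 h] at hz; exact hz.1)⟩
  exact M.closure_subset_closure hsub (hC.mem_closure_sdiff_singleton_of_mem hxC)

/-- **Series is symmetric**: if `y` is a coloop of `M ＼ {x}` then `x` is a coloop of `M ＼ {y}` (coloop-free `M`). -/
theorem isColoop_delete_symm (M : Matroid α) (hK : ∀ e, ¬ M.IsColoop e) {x y : α} (hxE : x ∈ M.E)
    (hy : (M ＼ {x}).IsColoop y) : (M ＼ {y}).IsColoop x := by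
  rw [Matroid.delete_isColoop_iff] at hy ⊢
  obtain ⟨hycl, hyE, hyx⟩ := hy
  have hyx' : y ≠ x := fun h => hyx (mem_singleton_iff.2 h)
  have hy1 : y ∈ M.closure (M.E \ {y}) := by
    by_contra h
    exact hK y ((Matroid.isColoop_iff_notMem_closure_compl hyE).2 h)
  have hX : M.E \ {y} = insert x ((M.E \ {x}) \ {y}) := by
    ext z
    simp only [mem_sdiff, mem_singleton_iff, mem_insert_iff]
    constructor
    · rintro ⟨hz, hzy⟩
      by_cases hzx : z = x
      · exact Or.inl hzx
      · exact Or.inr ⟨⟨hz, hzx⟩, hzy⟩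
    · rintro (rfl | ⟨⟨hz, _⟩, hzy⟩)
      · exact ⟨hxE, hyx'.symm⟩
      · exact ⟨hz, hzy⟩
  rw [hX] at hy1
  have hex := Matroid.closure_exchange (M := M) (e := y) (f := x) (X := (M.E \ {x}) \ {y}) ⟨hy1, hycl⟩
  refine ⟨?_, hxE, fun h => hyx' (mem_singleton_iff.1 h).symm⟩
  have : (M.E \ {y}) \ {x} = (M.E \ {x}) \ {y} := by
    ext z; simp only [mem_sdiff, mem_singleton_iff]; tauto
  rw [this]
  exact hex.2

/-- The coloops of `M ＼ {x}` form a finite set inside `M.E ∖ {x}`. -/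
theorem coloops_delete_subset (M : Matroid α) (x : α) : (M ＼ {x}).coloops ⊆ M.E \ {x} := by
  intro y hy
  have h := (Matroid.delete_isColoop_iff M {x}).1 (Matroid.isColoop_iff_mem_coloops.2 hy)
  exact ⟨h.2.1, h.2.2⟩

/-- **A point with `≥ 4` series partners lies on no four-circuit** (a four-circuit through `x` would contain five points). -/
theorem ncard_fourCircuitsThrough_eq_zero_of_four_le_coloops_delete (M : Matroid α) [M.Finite]
    (hK : ∀ e, ¬ M.IsColoop e) {x : α} (h4 : 4 ≤ (M ＼ {x}).coloops.ncard) :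
    {C : Set α | M.IsCircuit C ∧ C.ncard = 4 ∧ x ∈ C}.ncard = 0 := by
  rw [ncard_eq_zero (M.ground_finite.finite_subsets.subset (fun C hC => hC.1.subset_ground))]
  ext C
  simp only [mem_setOf_eq, mem_empty_iff_false, iff_false, not_and]
  intro hC h4' hxC
  have hsub : insert x (M ＼ {x}).coloops ⊆ C := by
    intro z hz
    rcases mem_insert_iff.1 hz with rfl | hz
    · exact hxC
    · exact mem_of_isColoop_delete_of_isCircuit M hK (Matroid.isColoop_iff_mem_coloops.2 hz) hC hxC
  have hfin : (M ＼ {x}).coloops.Finite := M.ground_finite.subset ((coloops_delete_subset M x).trans sdiff_subset)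
  have hx : x ∉ (M ＼ {x}).coloops := fun h => (coloops_delete_subset M x h).2 (mem_singleton x)
  have h5 : 5 ≤ (insert x (M ＼ {x}).coloops).ncard := by
    rw [ncard_insert_of_notMem hx hfin]; omega
  have := ncard_le_ncard hsub (M.ground_finite.subset hC.subset_ground)
  omega

/-- **A point with `2` or more series partners lies on at most one four-circuit**: two such circuits share `x` and the partners, and the
elimination of `x` gives a circuit avoiding the partners (every circuit through a partner contains `x`), hence of size `≤ 2`. -/
theorem ncard_fourCircuitsThrough_le_one_of_two_le_coloops_delete (M : Matroid α) [M.Finite]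
    (hfree : ∀ e ∈ M.E, ∃ A ⊆ M.E \ {e}, e ∉ M.closure A ∧ e ∉ M.closure ((M.E \ {e}) \ A))
    (hK : ∀ e, ¬ M.IsColoop e) {x : α} (h2 : 2 ≤ (M ＼ {x}).coloops.ncard) :
    {C : Set α | M.IsCircuit C ∧ C.ncard = 4 ∧ x ∈ C}.ncard ≤ 1 := by
  classical
  have hfin : (M ＼ {x}).coloops.Finite := M.ground_finite.subset ((coloops_delete_subset M x).trans sdiff_subset)
  obtain ⟨y₁, hy₁, y₂, hy₂, hne⟩ : ∃ y₁ ∈ (M ＼ {x}).coloops, ∃ y₂ ∈ (M ＼ {x}).coloops, y₁ ≠ y₂ := by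
    have := Set.one_lt_ncard (hs := hfin)
    exact this.1 (by omega)
  rw [ncard_le_one_iff (M.ground_finite.finite_subsets.subset (fun C hC => hC.1.subset_ground))]
  intro C C' hC hC'
  by_contra hCC'
  obtain ⟨hC, hC4, hxC⟩ := hC
  obtain ⟨hC', hC'4, hxC'⟩ := hC'
  have hxE : x ∈ M.E := hC.subset_ground hxC
  -- both circuits contain `x, y₁, y₂`
  have hy₁C := mem_of_isColoop_delete_of_isCircuit M hK (Matroid.isColoop_iff_mem_coloops.2 hy₁) hC hxC
  have hy₂C := mem_of_isColoop_delete_of_isCircuit M hK (Matroid.isColoop_iff_mem_coloops.2 hy₂) hC hxC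
  have hy₁C' := mem_of_isColoop_delete_of_isCircuit M hK (Matroid.isColoop_iff_mem_coloops.2 hy₁) hC' hxC'
  have hy₂C' := mem_of_isColoop_delete_of_isCircuit M hK (Matroid.isColoop_iff_mem_coloops.2 hy₂) hC' hxC'
  have hy₁x : y₁ ≠ x := fun h => (coloops_delete_subset M x hy₁).2 (mem_singleton_iff.2 h)
  have hy₂x : y₂ ≠ x := fun h => (coloops_delete_subset M x hy₂).2 (mem_singleton_iff.2 h)
  -- eliminate `x`
  obtain ⟨D, hDsub, hD⟩ := hC.elimination hC' hCC' x
  have hD3 := three_le_ncard_of_isCircuit_of_hfree M hfree hD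
  -- `D` avoids the partners: a circuit through `y₁` (or `y₂`) contains `x`, but `x ∉ D`
  have hxD : x ∉ D := fun h => (hDsub h).2 (mem_singleton x)
  have hy₁D : y₁ ∉ D := fun h =>
    hxD (mem_of_isColoop_delete_of_isCircuit M hK
      (isColoop_delete_symm M hK hxE (Matroid.isColoop_iff_mem_coloops.2 hy₁)) hD h)
  have hy₂D : y₂ ∉ D := fun h =>
    hxD (mem_of_isColoop_delete_of_isCircuit M hK
      (isColoop_delete_symm M hK hxE (Matroid.isColoop_iff_mem_coloops.2 hy₂)) hD h)
  -- so `D ⊆ (C ∪ C') ∖ {x, y₁, y₂}`, a set of at most `2` points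
  have hDsub' : D ⊆ (C ∪ C') \ {x, y₁, y₂} := by
    intro z hz
    refine ⟨(hDsub hz).1, ?_⟩
    simp only [mem_insert_iff, mem_singleton_iff, not_or]
    exact ⟨fun h => hxD (h ▸ hz), fun h => hy₁D (h ▸ hz), fun h => hy₂D (h ▸ hz)⟩
  have hCf : C.Finite := M.ground_finite.subset hC.subset_ground
  have hC'f : C'.Finite := M.ground_finite.subset hC'.subset_ground
  have hsub3 : ({x, y₁, y₂} : Set α) ⊆ C ∩ C' := by
    intro z hz
    simp only [mem_insert_iff, mem_singleton_iff] at hz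
    rcases hz with rfl | rfl | rfl
    · exact ⟨hxC, hxC'⟩
    · exact ⟨hy₁C, hy₁C'⟩
    · exact ⟨hy₂C, hy₂C'⟩
  have h3 : ({x, y₁, y₂} : Set α).ncard = 3 := by
    rw [ncard_insert_of_notMem (by simp [hy₁x.symm, hy₂x.symm]) (toFinite _), ncard_pair hne]
  have hinter : 3 ≤ (C ∩ C').ncard := h3 ▸ ncard_le_ncard hsub3 (hCf.subset inter_subset_left)
  have hunion : (C ∪ C').ncard ≤ 5 := by
    have := Set.ncard_union_add_ncard_inter C C' hCf hC'f
    omega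
  have hdiff : ((C ∪ C') \ {x, y₁, y₂}).ncard ≤ 2 := by
    have h := Set.ncard_sdiff (show ({x, y₁, y₂} : Set α) ⊆ C ∪ C' from
      (hsub3.trans inter_subset_left).trans subset_union_left) (toFinite _)
    rw [h, h3]
    omega
  have := ncard_le_ncard hDsub' ((hCf.union hC'f).subset sdiff_subset)
  omega

/-- **Deleting all the coloops keeps the nullity** (one coloop at a time). -/
theorem nullity_delete_coloops (N : Matroid α) [N.Finite] {d : ℕ} (hd : N.E.encard = N.eRank + d) :
    (N ＼ N.coloops).E.encard = (N ＼ N.coloops).eRank + d := by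
  have hfin : N.coloops.Finite := N.ground_finite.subset N.coloops_subset_ground
  suffices H : ∀ (K : Set α) (hK : K.Finite), K ⊆ N.coloops → (N ＼ K).E.encard = (N ＼ K).eRank + d from
    H N.coloops hfin Subset.rfl
  intro K hK
  induction K, hK using Set.Finite.induction_on with
  | empty => intro _; simpa using hd
  | @insert a s has hs ih =>
    intro hsub
    have hs' : s ⊆ N.coloops := (subset_insert a s).trans hsub
    have ha : N.IsColoop a := Matroid.isColoop_iff_mem_coloops.2 (hsub (mem_insert a s))
    have ha' : (N ＼ s).IsColoop a := by
      rw [Matroid.delete_isColoop_iff]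
      refine ⟨?_, ha.mem_ground, has⟩
      intro h
      have h2 := (Matroid.isColoop_iff_notMem_closure_compl ha.mem_ground).1 ha
      exact h2 (N.closure_subset_closure (show (N.E \ s) \ {a} ⊆ N.E \ {a} from sdiff_subset_sdiff_left sdiff_subset) h)
    have h := nullity_delete_singleton_of_isColoop (N ＼ s) ha' (ih hs')
    rw [Matroid.delete_delete, union_singleton] at h
    exact h

/-- **Deleting all the coloops leaves a coloop-free matroid**: `y ∉ coloops` means `y ∈ cl(E ∖ y) = cl((E ∖ K) ∖ y) ∪ K`. -/
theorem not_isColoop_delete_coloops (N : Matroid α) (y : α) : ¬ (N ＼ N.coloops).IsColoop y := by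
  intro hy
  rw [Matroid.delete_isColoop_iff] at hy
  obtain ⟨hycl, hyE, hyK⟩ := hy
  have hnc : ¬ N.IsColoop y := fun h => hyK (Matroid.isColoop_iff_mem_coloops.1 h)
  have hy1 : y ∈ N.closure (N.E \ {y}) := by
    by_contra h
    exact hnc ((Matroid.isColoop_iff_notMem_closure_compl hyE).2 h)
  have hX : N.E \ {y} = ((N.E \ N.coloops) \ {y}) ∪ N.coloops := by
    ext z
    simp only [mem_sdiff, mem_singleton_iff, mem_union]
    constructor
    · rintro ⟨hz, hzy⟩
      by_cases hzK : z ∈ N.coloops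
      · exact Or.inr hzK
      · exact Or.inl ⟨⟨hz, hzK⟩, hzy⟩
    · rintro (⟨⟨hz, _⟩, hzy⟩ | hzK)
      · exact ⟨hz, hzy⟩
      · exact ⟨N.coloops_subset_ground hzK, fun h => hyK (h ▸ hzK)⟩
  rw [hX, Matroid.closure_union_eq_of_subset_coloops _ Subset.rfl] at hy1
  rcases hy1 with h | h
  · exact hycl h
  · exact hyK h

/-- **Deleting the coloops keeps the four-circuits** (a circuit avoids the coloops). -/
theorem fourCircuits_delete_coloops_eq (N : Matroid α) :
    {C : Set α | (N ＼ N.coloops).IsCircuit C ∧ C.ncard = 4} = {C : Set α | N.IsCircuit C ∧ C.ncard = 4} := by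
  ext C
  simp only [mem_setOf_eq, Matroid.delete_isCircuit_iff]
  constructor
  · rintro ⟨⟨hC, -⟩, h4⟩; exact ⟨hC, h4⟩
  · rintro ⟨hC, h4⟩; exact ⟨⟨hC, hC.disjoint_coloops⟩, h4⟩

/-- **The no-point-count spread `s₄` cap at every nullity**: `s₄ ≤ capSum qSpreadSeven j` on every spread e-free core of nullity `j`
(the spread bridge at `j ≤ 7`, the star bound `perPointBound` beyond). -/
theorem ncard_fourCircuits_le_capSum_qSpreadSeven (M : Matroid α) [M.Finite]
    (hfree : ∀ e ∈ M.E, ∃ A ⊆ M.E \ {e}, e ∉ M.closure A ∧ e ∉ M.closure ((M.E \ {e}) \ A))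
    (hns : ¬ ∃ W ⊆ M.E, W.ncard ≤ 9 ∧ W.encard = M.eRk W + 4) {j : ℕ} (hd : M.E.encard = M.eRank + j) :
    {C : Set α | M.IsCircuit C ∧ C.ncard = 4}.ncard ≤ capSum qSpreadSeven j :=
  ncard_fourCircuits_le_sum_of_perPoint_hereditary
    (fun M' => ¬ ∃ W ⊆ M'.E, W.ncard ≤ 9 ∧ W.encard = M'.eRk W + 4)
    (fun M' x h => spread_delete M' h x) qSpreadSeven
    (by
      intro M' _ hfree' hns' i hi e he
      by_cases hi7 : i ≤ 7
      · exact ncard_fourCircuitsThrough_le_of_fourCapSpecSpread M' hfree' hi hns' he (fourCapSpecSpread_qSpreadSeven i hi7)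
      · have h7 : i ≠ 7 := by omega
        have h0 : i ≠ 0 := by omega
        have h1 : i ≠ 1 := by omega
        have h2 : i ≠ 2 := by omega
        have h3 : i ≠ 3 := by omega
        have h4 : i ≠ 4 := by omega
        have h5 : i ≠ 5 := by omega
        have h6 : i ≠ 6 := by omega
        simp only [qSpreadSeven, qSpread, h0, h1, h2, h3, h4, h5, h6, h7, if_false]
        exact ncard_fourCircuitsThrough_le_perPointBound M' hfree' hi e)
    M hfree hns hd

end S1

end PercRepro
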